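import Summits.MatrixMultiplication.MatrixMultiplication.Theses.DesignFlattening
import Literature.Computability.AlgebraicComplexity.KoszulFlatteningKronecker
import Literature.Computability.AlgebraicComplexity.XyzCubeFlattening
import Literature.LinearAlgebra.Matrix.RankMinors

/-!
# `DesignFlattening.RankThreeGadgetFloor` — border-rank-3 gadget schemes for `xyz^{⊠N}` need `(4/3)^N` terms

Closes support item `stmt-MatrixMultiplication-8039` of route `DesignFlattening`
(`Summit.MatrixMultiplication.MatrixMultiplication.Theses.DesignFlattening.RankThreeGadgetFloor`,
card Theorem (B)): every expression of the `N`-th Kronecker power of the tensor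
`X = xyz = Σ_{{a,b,c}={0,1,2}} e_a ⊗ e_b ⊗ e_c` as a sum of `k` Kronecker products
`⊗_i y_{ji}` of `3 × 3 × 3` tensors of (algebraic) border rank `≤ 3` has `k ≥ (4/3)^N`.

## Proof (a design flattening)

Let `F(t)` be the `p = 1` Koszul flattening of `t ∈ ℂ³ ⊗ ℂ³ ⊗ ℂ³` after the identity of `ℂ³`
(`koszulFlattening 1`, a `9 × 9` matrix, Landsberg–Ottaviani).  It is linear in `t`, so it has an
`N`-fold tensor power `F^{⊗N}` on `(ℂ³)^{⊗N} ⊗ (ℂ³)^{⊗N} ⊗ (ℂ³)^{⊗N}`, written here in coordinates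
(`Σ_a (Π_i w(a_i)) · X(a, b, c)` with `w` the wedge coefficients), and
`F^{⊗N}(⊗_i t_i) = ⊗_i F(t_i)` (Kronecker product of matrices).  Hence
`F^{⊗N}(X^{⊠N}) = F(X)^{⊗N}` has rank `rank F(X)^N ≥ 8^N` (an explicit upper-triangular `8 × 8`
minor of determinant `1`, computed over `ℤ`), while
`F^{⊗N}(Σ_j ⊗_i y_{ji}) = Σ_j ⊗_i F(y_{ji})` has rank `≤ Σ_j Π_i rank F(y_{ji}) ≤ k · 6^N` by the
Koszul border-rank bound `rank F(y) ≤ C(2,1) · bR(y) ≤ 6`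
(`rank_koszulFlattening_le_choose_mul_algBorderRank`, CGLV 2022 §3 eq. (8)) and multiplicativity of
matrix rank under Kronecker products (`matRank_kroneckerMap_mul`).  So `8^N ≤ k · 6^N`.

Everything used is a proved tree fact; the file introduces no definitions (the identity restriction
`ℤ³ → ℤ^{2·1+1}` and the minor are written as explicit terms).

References: Landsberg–Ottaviani 2015 (Thm. 2.1), Conner–Gesmundo–Landsberg–Ventura 2022 (§3),
Bürgisser–Clausen–Shokrollahi 1997 (rank of Kronecker products).
-/

namespace Summit.MatrixMultiplication.MatrixMultiplication.Theorems

open Literature.Computability.AlgebraicComplexity Matrix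
open scoped BigOperators

/-! ## Rank of an `N`-fold Kronecker product of matrices -/

/-- **Rank is multiplicative on `N`-fold Kronecker products**: for matrices `A_i` (`i < N`) over a
field, the matrix `(x, y) ↦ Π_i A_i(x_i, y_i)` on `(Fin N → m) × (Fin N → n)` has rank
`Π_i rank A_i` (induction on `N`, splitting off the first factor with `Fin.consEquiv` and using
`rank (A ⊗ B) = rank A · rank B`). [folklore] -/
theorem rank_of_prod_apply_eq_prod_rank {K : Type*} [Field K] {m n : Type*} [Fintype m] [Fintype n]
    [DecidableEq m] [DecidableEq n] :
    ∀ (N : ℕ) (A : Fin N → Matrix m n K),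
      (Matrix.of fun (x : Fin N → m) (y : Fin N → n) => ∏ i, A i (x i) (y i)).rank = ∏ i, (A i).rank
  | 0, A => by
      have e : (Matrix.of fun (x : Fin 0 → m) (y : Fin 0 → n) => ∏ i, A i (x i) (y i)) =
          (1 : Matrix Unit Unit K).submatrix ⇑(Equiv.equivPUnit (Fin 0 → m))
            ⇑(Equiv.equivPUnit (Fin 0 → n)) := by
        ext x y
        simp
      rw [e, Matrix.rank_submatrix, Matrix.rank_one, Fintype.card_unit, Fin.prod_univ_zero]
  | N + 1, A => by
      have ih : (Matrix.of fun (x : Fin N → m) (y : Fin N → n) =>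
            ∏ i : Fin N, A i.succ (x i) (y i)).rank = ∏ i : Fin N, (A i.succ).rank :=
        rank_of_prod_apply_eq_prod_rank N fun i : Fin N => A i.succ
      have e : (Matrix.of fun (x : Fin (N + 1) → m) (y : Fin (N + 1) → n) =>
              ∏ i, A i (x i) (y i)).submatrix
            ⇑(Fin.consEquiv fun _ => m) ⇑(Fin.consEquiv fun _ => n) =
          Matrix.kroneckerMap (· * ·) (A 0)
            (Matrix.of fun (x : Fin N → m) (y : Fin N → n) => ∏ i : Fin N, A i.succ (x i) (y i)) := by
        ext ⟨x0, x⟩ ⟨y0, y⟩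
        simp only [Matrix.submatrix_apply, Matrix.of_apply, Fin.consEquiv_apply,
          Matrix.kroneckerMap_apply, Fin.prod_univ_succ, Fin.cons_zero, Fin.cons_succ]
      rw [← Matrix.rank_submatrix _ (Fin.consEquiv fun _ => m) (Fin.consEquiv fun _ => n), e,
        matRank_kroneckerMap_mul, ih, Fin.prod_univ_succ]

/-! ## The Koszul flattening in coefficient form and its tensor powers -/

/-- **Coefficient form of the Koszul flattening**: for `Φ = M.mulVecLin`, the entry of `K_Φ(t)` in
row `(T, c)`, column `(S, b)` is `Σ_a (M e_a ∧ e_S)_T · t_{abc}` — linear in `t` with coefficients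
the wedge entries of the columns of `M`. [folklore] -/
theorem koszulFlattening_mulVecLin_eq_sum_wedge {K : Type*} [CommRing K] {ι κ μ : Type*} [Fintype ι]
    (p : ℕ) (M : Matrix (Fin (2 * p + 1)) ι K) (t : ι → κ → μ → K)
    (r : PSub (2 * p + 1) (p + 1) × μ) (c : PSub (2 * p + 1) p × κ) :
    koszulFlattening p M.mulVecLin t r c =
      ∑ a, wedgeMatrix (fun j => M j a) r.1.1 c.1.1 * t a c.2 r.2 := by
  rw [koszulFlattening_apply, wedgeMatrix_apply]
  simp only [wedgeMatrix_apply, Matrix.mulVecLin_apply, Matrix.mulVec, dotProduct, Finset.sum_mul]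
  rw [Finset.sum_comm]
  refine Finset.sum_congr rfl fun j _ => ?_
  split_ifs with h
  · rw [Finset.mul_sum]
    refine Finset.sum_congr rfl fun a _ => ?_
    ring
  · simp

/-- **Tensor powers of the flattening on product tensors**: the `N`-fold coefficient flattening
`(ρ, σ) ↦ Σ_a (Π_i (M e_{a_i} ∧ e_{S_i})_{T_i}) · Π_i y_i(a_i, b_i, c_i)` of a Kronecker product
`⊗_i y_i` is the Kronecker product of matrices `Π_i K_Φ(y_i)(ρ_i, σ_i)` (sum of products = product
of sums). [folklore] -/
theorem sum_prod_wedge_mul_prod_eq_prod_koszulFlattening {K : Type*} [CommRing K] {ι κ μ : Type*}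
    [Fintype ι] [DecidableEq ι] (p : ℕ) (M : Matrix (Fin (2 * p + 1)) ι K) (N : ℕ)
    (y : Fin N → ι → κ → μ → K) (ρ : Fin N → PSub (2 * p + 1) (p + 1) × μ)
    (σ : Fin N → PSub (2 * p + 1) p × κ) :
    ∑ a : Fin N → ι, (∏ i, wedgeMatrix (fun j => M j (a i)) (ρ i).1.1 (σ i).1.1) *
        ∏ i, y i (a i) (σ i).2 (ρ i).2 =
      ∏ i, koszulFlattening p M.mulVecLin (y i) (ρ i) (σ i) := by
  simp only [koszulFlattening_mulVecLin_eq_sum_wedge]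
  rw [Finset.prod_univ_sum (fun _ => Finset.univ)
      (fun i a => wedgeMatrix (fun j => M j a) (ρ i).1.1 (σ i).1.1 * y i a (σ i).2 (ρ i).2),
    Fintype.piFinset_univ]
  refine Finset.sum_congr rfl fun a _ => ?_
  rw [Finset.prod_mul_distrib]

/-! ## The `p = 1` flattening of `xyz` has rank `≥ 8` -/

/-- The `p = 1` Koszul flattening of `X = xyz` after the identity restriction, over `ℂ`, is the base
change of the same flattening over `ℤ`. [folklore] -/
theorem koszulFlattening_one_xyz_eq_map :
    koszulFlattening 1 ((Matrix.of fun (i : Fin (2 * 1 + 1)) (j : Fin 3) =>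
        if (i : ℕ) = (j : ℕ) then (1 : ℤ) else 0).map (Int.castRingHom ℂ)).mulVecLin (xyzTensor ℂ) =
      (koszulFlattening 1 (Matrix.of fun (i : Fin (2 * 1 + 1)) (j : Fin 3) =>
        if (i : ℕ) = (j : ℕ) then (1 : ℤ) else 0).mulVecLin (xyzTensor ℤ)).map (Int.castRingHom ℂ) := by
  rw [koszulFlattening_mulVecLin_map]
  congr 1
  funext a b c
  rw [xyzTensor_apply, xyzTensor_apply]
  split_ifs <;> simp

/-- **`rank F(X) ≥ 8`** for the `p = 1` Koszul flattening `F` of `X = xyz` after the identity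
restriction: the `8 × 8` minor on rows
`({0,1},0), ({0,1},1), ({0,2},0), ({0,2},2), ({1,2},1), ({1,2},2), ({0,1},2), ({0,2},1)` and columns
`({0},2), ({1},2), ({0},1), ({2},1), ({1},0), ({2},0), ({1},1), ({0},0)` is upper triangular with
diagonal `(-1,1,-1,1,-1,1,1,-1)`, hence has determinant `1` (computed over `ℤ` by `decide`).
(In fact `rank F(X) = 8`: the flattening has twelve entries `±1`, six in a signed permutation block
and six in a `3 × 3` block of rank `2`.) [folklore] -/
theorem eight_le_rank_koszulFlattening_one_xyz :
    8 ≤ (koszulFlattening 1 ((Matrix.of fun (i : Fin (2 * 1 + 1)) (j : Fin 3) =>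
        if (i : ℕ) = (j : ℕ) then (1 : ℤ) else 0).map (Int.castRingHom ℂ)).mulVecLin (xyzTensor ℂ)).rank := by
  rw [koszulFlattening_one_xyz_eq_map]
  set Fz := koszulFlattening 1 (Matrix.of fun (i : Fin (2 * 1 + 1)) (j : Fin 3) =>
    if (i : ℕ) = (j : ℕ) then (1 : ℤ) else 0).mulVecLin (xyzTensor ℤ) with hFz
  -- the minor
  set r8 : Fin 8 → PSub (2 * 1 + 1) (1 + 1) × Fin 3 :=
    ![(⟨{0, 1}, by decide⟩, 0), (⟨{0, 1}, by decide⟩, 1), (⟨{0, 2}, by decide⟩, 0),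
      (⟨{0, 2}, by decide⟩, 2), (⟨{1, 2}, by decide⟩, 1), (⟨{1, 2}, by decide⟩, 2),
      (⟨{0, 1}, by decide⟩, 2), (⟨{0, 2}, by decide⟩, 1)] with hr8
  set c8 : Fin 8 → PSub (2 * 1 + 1) 1 × Fin 3 :=
    ![(⟨{0}, by decide⟩, 2), (⟨{1}, by decide⟩, 2), (⟨{0}, by decide⟩, 1),
      (⟨{2}, by decide⟩, 1), (⟨{1}, by decide⟩, 0), (⟨{2}, by decide⟩, 0),
      (⟨{1}, by decide⟩, 1), (⟨{0}, by decide⟩, 0)] with hc8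
  have htri : (Fz.submatrix r8 c8).BlockTriangular id := by
    unfold Matrix.BlockTriangular
    rw [hFz, hr8, hc8]
    decide
  have hdiag : ∏ i, Fz.submatrix r8 c8 i i = 1 := by
    rw [hFz, hr8, hc8]
    decide
  have hdet : (Fz.submatrix r8 c8).det = 1 := by
    rw [Matrix.det_of_upperTriangular htri, hdiag]
  have h := Literature.LinearAlgebra.Matrix.card_le_rank_of_det_submatrix_ne_zero
    (Fz.map (Int.castRingHom ℂ)) r8 c8 (by
      rw [Matrix.submatrix_map, ← RingHom.mapMatrix_apply, ← RingHom.map_det, hdet, map_one]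
      exact one_ne_zero)
  simpa using h

/-- **`rank F(y) ≤ 6` on gadgets**: for a `3 × 3 × 3` tensor `y` of border rank `≤ 3`, the `p = 1`
Koszul flattening after any restriction `M` has rank `≤ C(2,1) · bR(y) ≤ 6`
(Landsberg–Ottaviani; CGLV 2022, §3, eq. (8), the tree's
`rank_koszulFlattening_le_choose_mul_algBorderRank`). [folklore] -/
theorem rank_koszulFlattening_one_le_six (M : Matrix (Fin (2 * 1 + 1)) (Fin 3) ℂ)
    (y : Fin 3 → Fin 3 → Fin 3 → ℂ) (hy : algBorderRank y ≤ 3) :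
    (koszulFlattening 1 M.mulVecLin y).rank ≤ 6 := by
  have h := rank_koszulFlattening_le_choose_mul_algBorderRank 1 M y
  have h2 : (2 * 1).choose 1 = 2 := by decide
  rw [h2] at h
  omega

/-! ## The theorem -/

/-- **Card Theorem (B) of route `DesignFlattening`** (item `stmt-MatrixMultiplication-8039`): if
`xyz^{⊠N} = Σ_{j<k} ⊗_{i<N} y_{ji}` entrywise with every `y_{ji}` a `3 × 3 × 3` tensor of algebraic
border rank `≤ 3`, then `(4/3)^N ≤ k` — no single-copy border-rank-`3` gadget scheme certifies
anything below `3^N · (4/3)^N = 4^N = bR(cw₂)^N`.  Proof: apply the `N`-th tensor power of the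
`p = 1` Koszul flattening `F`; on the left `rank F(xyz)^N ≥ 8^N`, on the right
`≤ Σ_j Π_i rank F(y_{ji}) ≤ k · 6^N`. [folklore] -/
theorem rankThreeGadgetFloor_proof :
    Summit.MatrixMultiplication.MatrixMultiplication.Theses.DesignFlattening.RankThreeGadgetFloor := by
  unfold Summit.MatrixMultiplication.MatrixMultiplication.Theses.DesignFlattening.RankThreeGadgetFloor
  intro N k y hy hdec
  -- the identity restriction and the flattening `F`
  set M₁ : Matrix (Fin (2 * 1 + 1)) (Fin 3) ℂ := (Matrix.of fun (i : Fin (2 * 1 + 1)) (j : Fin 3) =>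
    if (i : ℕ) = (j : ℕ) then (1 : ℤ) else 0).map (Int.castRingHom ℂ) with hM₁
  -- the `N`-th tensor power of `F` applied to `xyz^{⊠N}`
  set B : Matrix (Fin N → PSub (2 * 1 + 1) (1 + 1) × Fin 3) (Fin N → PSub (2 * 1 + 1) 1 × Fin 3) ℂ :=
    Matrix.of fun ρ σ => ∑ a : Fin N → Fin 3,
      (∏ i, wedgeMatrix (fun j => M₁ j (a i)) (ρ i).1.1 (σ i).1.1) *
        kroneckerPow (xyzTensor ℂ) N a (fun i => (σ i).2) (fun i => (ρ i).2) with hB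
  -- (1) `B = F(xyz)^{⊗N}`
  have hB1 : B = Matrix.of fun ρ σ => ∏ i : Fin N,
      (fun _ : Fin N => koszulFlattening 1 M₁.mulVecLin (xyzTensor ℂ)) i (ρ i) (σ i) := by
    ext ρ σ
    simp only [hB, Matrix.of_apply, kroneckerPow_apply]
    exact sum_prod_wedge_mul_prod_eq_prod_koszulFlattening 1 M₁ N (fun _ => xyzTensor ℂ) ρ σ
  -- (2) `B = Σ_j ⊗_i F(y j i)`
  have hB2 : B = ∑ j : Fin k, Matrix.of fun ρ σ => ∏ i : Fin N,
      (fun i => koszulFlattening 1 M₁.mulVecLin (y j i)) i (ρ i) (σ i) := by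
    ext ρ σ
    simp only [hB, Matrix.of_apply, hdec, Finset.mul_sum, Matrix.sum_apply]
    rw [Finset.sum_comm]
    refine Finset.sum_congr rfl fun j _ => ?_
    exact sum_prod_wedge_mul_prod_eq_prod_koszulFlattening 1 M₁ N (y j) ρ σ
  -- (3) lower bound `8^N ≤ rank B`
  have hlow : 8 ^ N ≤ B.rank := by
    rw [hB1, rank_of_prod_apply_eq_prod_rank, Fin.prod_const]
    exact Nat.pow_le_pow_left (hM₁ ▸ eight_le_rank_koszulFlattening_one_xyz) N
  -- (4) upper bound `rank B ≤ k · 6^N`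
  have hup : B.rank ≤ k * 6 ^ N := by
    rw [hB2]
    refine (matrix_rank_sum_le _ _).trans ?_
    have hterm : ∀ j ∈ (Finset.univ : Finset (Fin k)),
        (Matrix.of fun (ρ : Fin N → PSub (2 * 1 + 1) (1 + 1) × Fin 3)
          (σ : Fin N → PSub (2 * 1 + 1) 1 × Fin 3) => ∏ i : Fin N,
          (fun i => koszulFlattening 1 M₁.mulVecLin (y j i)) i (ρ i) (σ i)).rank ≤ 6 ^ N := by
      intro j _
      rw [rank_of_prod_apply_eq_prod_rank, ← Fin.prod_const]
      exact Finset.prod_le_prod (fun i _ => Nat.zero_le _)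
        fun i _ => rank_koszulFlattening_one_le_six M₁ (y j i) (hy j i)
    refine (Finset.sum_le_sum hterm).trans ?_
    simp
  -- (5) conclude: `8^N ≤ k · 6^N`, i.e. `(4/3)^N ≤ k`
  have hnat : 8 ^ N ≤ k * 6 ^ N := hlow.trans hup
  have hreal : ((4 : ℝ) / 3) ^ N * 6 ^ N ≤ (k : ℝ) * 6 ^ N := by
    rw [← mul_pow]
    norm_num
    exact_mod_cast hnat
  exact le_of_mul_le_mul_right hreal (by positivity)

end Summit.MatrixMultiplication.MatrixMultiplication.Theorems
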